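import Summits.NavierStokesRegularity.OSWSelfSimilar.SheetRSpectrumPointAssembly
import Summits.NavierStokesRegularity.OSWSelfSimilar.SheetRSpectrumEndToEnd
import HarnessLib

/-!
# Sheet-ℝ spectral certificate (Z3-SR-SPEC, S2): THE GLUE AND THE END-TO-END WORD FROM POINT RECORDS —
# the Evans function does not depend on the encoding of `DG(Ω*)`, so the point-record certificate (centre encoding) feeds the word at `Ω*`

HONEST FRAMING (cell ns-blowup GROUP B «PROFILE SEARCH»; PROFILE-SPEC v1.3 case Z3-SR-SPEC; 1-D MODEL (viscous gCLM/OSW sheet on `ℝ` at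
`(a, c_l, ε) = (1/5, 1/2, 1)`); computer-assisted; not Euler/NS; «violates: none — MODEL»; census hook
`Literature.Analysis.FluidPDE.effectiveViscosity_half`). Nothing here is a statement about Navier–Stokes; NO enclosure and NO datum is proved here.
WHAT IT DOES (seat ns-blowup-profile-cert-2 g8; composition of tree theorems only):
* §1 `resolventOdd_reencode` / `evansOdd_reencode`: the odd-class resolvent — hence the Evans function — of the linearisation at `Ω*` is THE SAME
  for the two encodings of record, the centre encoding `(drift a Ω̄, potential L λ Ω̄, −PopC̄ + F′ + B_u)` (cert-5's (P8) `gardingDataKC_perturbedCentre`,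
  the one `SheetRSpectrumPointAssembly` is keyed on) and the `Ω*` encoding `(drift a Ω*, potential L λ Ω*, −PopC* + F′)` (cert-5's
  `gardingDataKC_star_of_centre`, the one `SheetRSpectrumEndToEnd` is keyed on): by `SheetRCentreReencoding.isWeakImage_reencode` (same weak form) and
  selfsim's `weak_of_mem_domain` / `mem_domain_of_weak` / `resolventOdd_generatorOdd` (the resolvent is characterised by the weak image);
* §2 `weakEigen_set_eq_singleton_of_pointData` / `weakEigen_one_simple_of_pointData`: cert-5's `SheetRSpectrumEndToEnd.weakEigen_set_eq_singleton_of_record`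
  / `weakEigen_one_simple_of_record` WITH HYPOTHESIS (iii) «implementation 2's `RectLabelCertificate` + forward far-field chain and literal for the
  `Ω*`-encoded Evans function» REPLACED BY implementation 2's POINT RECORDS and FAR RECORD at the centre datum (`PointData`, `MixedFarDatum`, kit
  j270205) + `‖h‖²_w ≤ hw2`: the certificate and the far-field exclusion come from `SheetRSpectrumPointAssembly.sheet_certificate_of_record`, are moved
  to the `Ω*` encoding by §1, and are fed to selfsim's `weakEigen_set_eq_singleton` / `weakEigen_one_simple` together with cert-5's (P6) gauge mode
  `exists_real_gaugeMode`. (The forward order-3 far-field hypothesis `hB` of the `_of_record` theorems at `R = 1141/100` is not met by any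
  arithmetic of record — implementation 1's forward `R₀` is `12.5`; the MIXED record closes at `11.406`.)
AFTER THIS FILE the odd-class Z3-SR-SPEC word «{σ : Re σ > −3/100 ∧ −DG(Ω*)|odd has a non-trivial weak eigenvector at σ} = {1}, σ = 1 simple» is a
kernel theorem modulo EXACTLY: the (S1) Gårding sentence at the centre `Ω̄` [interval, two arithmetics], `‖u‖_E ≤ rE♯₂` with `Ω* = Ω̄ + prim (der u)`
[existence row], implementation 2's 19 point records + far record [interval, kit j270205, literals refuter-re-derived] + `‖h‖²_w ≤ hw2`, and the weak
zero of record with `Ω*(X₀) ≠ 0`. WHAT THIS IS NOT: not NS; no number of record moves.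
-/

noncomputable section

namespace Summit.NavierStokesRegularity.OSWSelfSimilar
namespace SheetRSpectrumPointEndToEnd

open _root_.MeasureTheory _root_.Set _root_.Filter _root_.Real Literature.Analysis.Fourier SheetRWeakProfilePV SheetRWeakToStrong
  SheetREnergyClass SheetRWeightedMeasure SheetREnergySpace SheetRLinearisedTests SheetRTestSpace SheetRLinearisedFormBounds
  SheetRSolutionOperator SheetRComplexPivot SheetRAssemblyOperators SheetRCertificateAssembly SheetRGeneratorOddWeak SheetROddClass
  SheetRResolventOddClass SheetREvansOdd SheetRSpectrumWindingLists SheetRSpectrumOddAssembly SheetRSpectrumOddAssemblyReal SheetRWeakEigenReal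
  SheetRPerturbedResolventC SheetRLinearisationPerturbation SheetRTimeShiftModeWeak SheetRTimeShiftModeWeakEigen SheetRCentreReencoding
  SheetRSpectrumStepRule SheetRSpectrumPointCertificate SheetRResolventConj SheetRSpectrumPointAssembly SheetRSpectrumEndToEnd
  Literature.Analysis.OperatorTheory Complex
open scoped Topology ENNReal InnerProductSpace ContDiff

/-! ### §1 The resolvent and the Evans function do not depend on the encoding -/

section Reencode

variable {L : ℝ} (hL : 0 < L) (lam a : ℝ) {Ω Ω₁ Ωs Ωs₁ : ℝ → ℝ} {H₀ Hs : ℝ}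
  (hc : IsCentre L Ω Ω₁ H₀) (hcs : IsCentre L Ωs Ωs₁ Hs) (u : Esp L hL) (hsum : ∀ y, Ωs y = Ω y + prim (der u) y)

include hsum in
/-- **The odd-class resolvent is the same for the two encodings** (on the common half-plane): centre encoding
`(drift a Ω̄, potential L λ Ω̄, −PopC̄ + F′ + B_u)` with datum `h₁`, `Ω*` encoding `(drift a Ω*, potential L λ Ω*, −PopC* + F′)` with datum `h₂`,
`Ω* = Ω̄ + prim (der u)`. [folklore] -/
theorem resolventOdd_reencode (F' : Esp L hL →L[ℝ] W L) {D₀ D₁ V₀ c m D₀' D₁' V₀' c' m' : ℝ}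
    (h₁ : GardingDataKC L hL (drift a Ω) (potential L lam Ω) (-PopC hL lam a hc + F' + (Qop hL a u + (Qop hL a).flip u)) D₀ D₁ V₀ c m)
    (h₂ : GardingDataKC L hL (drift a Ωs) (potential L lam Ωs) (-PopC hL lam a hcs + F') D₀' D₁' V₀' c' m')
    {σ : ℂ} (hσ : -m < σ.re) (hσ' : -m' < σ.re) (G : Wcodd L) :
    resolventOdd hL _ h₁ σ G = resolventOdd hL _ h₂ σ G := by
  have hu₁ := resolventOdd_mem_domain hL _ h₁ hσ hσ G
  obtain ⟨P, hP, hw⟩ := weak_of_mem_domain hL _ h₁ hσ hu₁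
  rw [generatorOdd_resolventOdd hL _ h₁ hσ hσ G] at hw
  have hF : (-(((σ • resolventOdd hL _ h₁ σ G - G : Wcodd L)) : Wc L)) = (((G - σ • resolventOdd hL _ h₁ σ G : Wcodd L)) : Wc L) := by
    rw [Submodule.coe_sub, Submodule.coe_sub, Submodule.coe_smul, neg_sub]
  rw [hF] at hw
  have hw₂ := (isWeakImage_reencode hL lam a hc hcs u hsum F' P _).2 hw
  obtain ⟨hu₂, hT₂⟩ := mem_domain_of_weak hL _ h₂ hσ' hP hw₂
  have key := resolventOdd_generatorOdd hL _ h₂ hσ' hσ' hu₂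
  rw [hT₂] at key
  have e : σ • resolventOdd hL _ h₁ σ G - -(G - σ • resolventOdd hL _ h₁ σ G) = G := by abel
  rw [e] at key
  exact key.symm

include hsum in
/-- **The Evans function is the same for the two encodings** when the two data share the half-plane abscissa `m` (as the data of record do:
`gardingDataKC_reencode` keeps `(c, m)`): equal as functions on `ℂ` (outside the half-plane both resolvents are `0`). [folklore] -/
theorem evansOdd_reencode (F' : Esp L hL →L[ℝ] W L) {D₀ D₁ V₀ c m D₀' D₁' V₀' c' : ℝ}
    (h₁ : GardingDataKC L hL (drift a Ω) (potential L lam Ω) (-PopC hL lam a hc + F' + (Qop hL a u + (Qop hL a).flip u)) D₀ D₁ V₀ c m)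
    (h₂ : GardingDataKC L hL (drift a Ωs) (potential L lam Ωs) (-PopC hL lam a hcs + F') D₀' D₁' V₀' c' m)
    (ℓ : Wcodd L →L[ℂ] ℂ) (f : Wcodd L) (θ : ℂ) :
    evansOdd hL _ h₁ ℓ f θ = evansOdd hL _ h₂ ℓ f θ := by
  funext σ
  rw [evansOdd, evansOdd]
  by_cases hσ : -m < σ.re
  · rw [resolventOdd_reencode hL lam a hc hcs u hsum F' h₁ h₂ hσ hσ f]
  · have h0 : ∀ {K : Esp L hL →L[ℝ] W L} {d' V' : ℝ → ℝ} {A B C cc : ℝ} (h : GardingDataKC L hL d' V' K A B C cc m),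
        resolventOdd hL K h σ f = 0 := by
      intro K d' V' A B C cc h
      apply Subtype.ext
      rw [coe_resolventOdd, resolventKC_apply, resolventRKC_of_not hL K h hσ, Submodule.coe_zero]
      rfl
    rw [h0 h₁, h0 h₂]

end Reencode

/-! ### §2 The word of record from implementation 2's point records -/

/-- `Im (ofRealW g) = 0`. [folklore] -/
theorem imW_ofRealW {L : ℝ} (g : W L) : imW L (ofRealW L g) = 0 := by
  have e : imW L (ofRealW L g) = (toPair L (ofRealW L g)).snd := rfl
  rw [e, toPair_ofRealW]
  rfl

section Record

open CertificateViscousSheetRSpectrum (c1 c2 gamma Delta hw2)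
open CertificateViscousSheetR (Llip rEsharp2)

variable {h8 : (0 : ℝ) < 8} {Ω Ω₁ Ωs Ωs₁ : ℝ → ℝ} {H₀ Hs : ℝ} (hc : IsCentre 8 Ω Ω₁ H₀) (hcs : IsCentre 8 Ωs Ωs₁ Hs)
  (u : Esp 8 h8) (hsum : ∀ y, Ωs y = Ω y + prim (der u) y)
  (hR : W 8) (hh : hR ∈ Wodd 8) {D₀ D₁ V₀ : ℝ}
  (hS1 : GardingDataKC 8 h8 (drift (1 / 5) Ω) (potential 8 4 Ω)
    (-PopC h8 4 (1 / 5) hc + ((4 : ℝ) • ((innerSL ℝ hR).comp (ιE h8))).smulRight hR) D₀ D₁ V₀ (1 / 5) (3 / 20))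
  (hu : ‖u‖ ≤ (CertificateViscousSheetR.rEsharp2 : ℝ))
  (hPD : PointData (resolventKC h8 _ hS1) (ofRealW 8 hR) (ofRealW 8 hR) 4
    (evansOdd h8 _ hS1 ((innerSL ℂ (ofRealW 8 hR)).comp (Wcodd 8).subtypeL) (realOdd hR hh) 4))
  (hFD : MixedFarDatum (resolventKC h8 _ hS1) (ofRealW 8 hR) (ofRealW 8 hR) 1 ((3593635617 : ℝ) / 5000000000)
    ((331182857 : ℝ) / 250000000) ((802337581 : ℝ) / 500000000) ((1710547133 : ℝ) / 1000000000))
  (hhw : ‖ofRealW 8 hR‖ ^ 2 ≤ ((hw2 : ℚ) : ℝ))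
  (hweak : ∀ ψ : ℝ → ℝ, ContDiff ℝ ∞ ψ → HasCompactSupport ψ →
    (∫ x, (Ωs x + 1 / 2 * x * Ωs₁ x + 1 / 5 * (∫ s in (0 : ℝ)..x, hilbertTransform Ωs s) * Ωs₁ x
      - hilbertTransform Ωs x * Ωs x) * ψ x) + ∫ x, Ωs₁ x * deriv ψ x = 0)
  {X₀ : ℝ} (hX₀ : Ωs X₀ ≠ 0)

include hPD hFD hhw in
/-- **`RectLabelCertificate` and the far-field exclusion for THE Evans function at `Ω*`** (`Ω*` encoding, datum `gardingDataKC_star_of_centre`),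
from implementation 2's point records at the centre datum: `sheet_certificate_of_record` + `evansOdd_reencode`. [folklore] -/
theorem certificate_star_of_pointData :
    RectLabelCertificate (evansOdd h8 _ (gardingDataKC_star_of_centre 4 hc hcs u hsum hR hR 4 hS1 hu Llip_mul_rEsharp2_lt)
        ((innerSL ℂ (ofRealW 8 hR)).comp (Wcodd 8).subtypeL) (realOdd hR hh) 4) ∧
      ∀ σ : ℂ, ra < σ.re → (1141 : ℝ) / 100 < ‖σ‖ →
        evansOdd h8 _ (gardingDataKC_star_of_centre 4 hc hcs u hsum hR hR 4 hS1 hu Llip_mul_rEsharp2_lt)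
          ((innerSL ℂ (ofRealW 8 hR)).comp (Wcodd 8).subtypeL) (realOdd hR hh) 4 σ ≠ 0 := by
  -- the centre-encoded perturbed datum (P8)
  have hK₁ := gardingDataKC_certifiedZero hS1 u hu Llip_mul_rEsharp2_lt
  have hc' : ((c2 : ℚ) : ℝ) ≤ 1 / 5 := by norm_num [c2]
  have hm' : ((c1 : ℚ) : ℝ) + ((gamma : ℚ) : ℝ) ≤ 3 / 20 := by norm_num [c1, gamma]
  have hm₁ : (3 : ℝ) / 20 - ((Delta : ℚ) : ℝ) / 4 ≤ 3 / 20 - CertificateViscousSheetR.Llip * CertificateViscousSheetR.rEsharp2 / 4 := by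
    norm_num [Delta, CertificateViscousSheetR.Llip, CertificateViscousSheetR.rEsharp2]
  have hKK : ‖(-PopC h8 4 (1 / 5) hc + ((4 : ℝ) • ((innerSL ℝ hR).comp (ιE h8))).smulRight hR
        + (Qop h8 (1 / 5) u + (Qop h8 (1 / 5)).flip u))
        - (-PopC h8 4 (1 / 5) hc + ((4 : ℝ) • ((innerSL ℝ hR).comp (ιE h8))).smulRight hR)‖ ≤ ((Delta : ℚ) : ℝ) / 2 := by
    rw [add_sub_cancel_left]
    have hD : ((Delta : ℚ) : ℝ) = CertificateViscousSheetR.Llip * CertificateViscousSheetR.rEsharp2 := by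
      norm_num [Delta, CertificateViscousSheetR.Llip, CertificateViscousSheetR.rEsharp2]
    have hL0 : (0 : ℝ) ≤ (CertificateViscousSheetR.Llip : ℝ) := by norm_num [CertificateViscousSheetR.Llip]
    refine (norm_secondVariation_le_sheet h8 u).trans ?_
    rw [hD]
    nlinarith
  obtain ⟨hcert, hfar⟩ := sheet_certificate_of_record h8 _ _ hS1 hK₁ hc' hm' hm₁ hKK (imW_ofRealW hR) (coe_realOdd hR hh) hhw hPD hFD
  have heq := evansOdd_reencode h8 4 (1 / 5) hc hcs u hsum (((4 : ℝ) • ((innerSL ℝ hR).comp (ιE h8))).smulRight hR) hK₁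
    (gardingDataKC_star_of_centre 4 hc hcs u hsum hR hR 4 hS1 hu Llip_mul_rEsharp2_lt)
    ((innerSL ℂ (ofRealW 8 hR)).comp (Wcodd 8).subtypeL) (realOdd hR hh) 4
  rw [heq] at hcert hfar
  exact ⟨hcert, hfar⟩

include hc u hsum hS1 hu hPD hFD hhw hweak hX₀ in
/-- **THE WORD OF RECORD FROM POINT RECORDS** — cert-5's `weakEigen_set_eq_singleton_of_record` with hypothesis (iii) replaced by implementation 2's point
records + far record + `‖h‖²_w ≤ hw2`: «{σ : Re σ > −3/100 ∧ −DG(Ω*)|odd has a non-trivial weak eigenvector at σ} = {1}» (lift strength written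
`(4 : ℂ)`; cert-5's statement carries `((4 : ℝ) : ℂ)`, equal by `norm_num`). MODEL statement; not NS. [folklore] -/
theorem weakEigen_set_eq_singleton_of_pointData :
    {σ : ℂ | ra < σ.re ∧ ∃ w : Wcodd 8, w ≠ 0 ∧
      IsWeakEigen h8 (-PopC h8 4 (1 / 5) hcs + ((4 : ℝ) • ((innerSL ℝ hR).comp (ιE h8))).smulRight hR) (drift (1 / 5) Ωs)
        (potential 8 4 Ωs) ((innerSL ℂ (ofRealW 8 hR)).comp (Wcodd 8).subtypeL) (realOdd hR hh) 4 σ w} = {1} := by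
  obtain ⟨hcert, hfar⟩ := certificate_star_of_pointData hc hcs u hsum hR hh hS1 hu hPD hFD hhw
  obtain ⟨p, hp, -, hwp⟩ := exists_real_gaugeMode h8 4 (1 / 5) hcs hR hR 4 hweak hX₀
  have hv1 := weakEigen_one_real h8 _ (gardingDataKC_star_of_centre 4 hc hcs u hsum hR hR 4 hS1 hu Llip_mul_rEsharp2_lt) hR hR hh 4 hwp
  have e4 : ((4 : ℝ) : ℂ) = (4 : ℂ) := by norm_num
  rw [e4] at hv1
  exact weakEigen_set_eq_singleton h8 _ _ neg_mstar_lt_ra _ _ _ hcert hfar (cplx_ne_zero h8 hp) hv1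

include hc u hsum hS1 hu hPD hFD hhw hweak hX₀ in
/-- **… and `σ = 1` is simple, from point records.** MODEL statement; not NS. [folklore] -/
theorem weakEigen_one_simple_of_pointData :
    resolventOdd h8 _ (gardingDataKC_star_of_centre 4 hc hcs u hsum hR hR 4 hS1 hu Llip_mul_rEsharp2_lt) 1 (realOdd hR hh) ≠ 0 ∧
      (∀ w : Wcodd 8,
        IsWeakEigen h8 (-PopC h8 4 (1 / 5) hcs + ((4 : ℝ) • ((innerSL ℝ hR).comp (ιE h8))).smulRight hR) (drift (1 / 5) Ωs)
            (potential 8 4 Ωs) ((innerSL ℂ (ofRealW 8 hR)).comp (Wcodd 8).subtypeL) (realOdd hR hh) 4 1 w ↔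
          ∃ t : ℂ, w = t • resolventOdd h8 _ (gardingDataKC_star_of_centre 4 hc hcs u hsum hR hR 4 hS1 hu Llip_mul_rEsharp2_lt) 1 (realOdd hR hh)) ∧
      ∀ δ₀ : Wcodd 8, δ₀ ≠ 0 →
        IsWeakEigen h8 (-PopC h8 4 (1 / 5) hcs + ((4 : ℝ) • ((innerSL ℝ hR).comp (ιE h8))).smulRight hR) (drift (1 / 5) Ωs)
            (potential 8 4 Ωs) ((innerSL ℂ (ofRealW 8 hR)).comp (Wcodd 8).subtypeL) (realOdd hR hh) 4 1 δ₀ →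
          ¬ ∃ δ₁ : Wcodd 8,
            IsWeakJordan h8 (-PopC h8 4 (1 / 5) hcs + ((4 : ℝ) • ((innerSL ℝ hR).comp (ιE h8))).smulRight hR) (drift (1 / 5) Ωs)
              (potential 8 4 Ωs) ((innerSL ℂ (ofRealW 8 hR)).comp (Wcodd 8).subtypeL) (realOdd hR hh) 4 1 δ₀ δ₁ := by
  obtain ⟨hcert, -⟩ := certificate_star_of_pointData hc hcs u hsum hR hh hS1 hu hPD hFD hhw
  obtain ⟨p, hp, -, hwp⟩ := exists_real_gaugeMode h8 4 (1 / 5) hcs hR hR 4 hweak hX₀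
  have hv1 := weakEigen_one_real h8 _ (gardingDataKC_star_of_centre 4 hc hcs u hsum hR hR 4 hS1 hu Llip_mul_rEsharp2_lt) hR hR hh 4 hwp
  have e4 : ((4 : ℝ) : ℂ) = (4 : ℂ) := by norm_num
  rw [e4] at hv1
  exact weakEigen_one_simple h8 _ _ neg_mstar_lt_ra _ _ _ hcert (cplx_ne_zero h8 hp) hv1

end Record

end SheetRSpectrumPointEndToEnd
end Summit.NavierStokesRegularity.OSWSelfSimilar

end
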